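/-
Copyright (c) 2026 the pub-hodgecm-mathlib formalisation cell (harness21).  Prover seat hodgecm-mathlib-K2E3-p23 (g4), Track B «K2-LIT» ∕ h413
(`stmt-HodgeConjecture-24833`), line `K2_E3_EllipticInputs`, road «GL₂-sc» (road owner K2E5-p17 (g5); dealer RULINGS #1 (R-2) 2026-09-04 08:53Z), brick (2E-a1) = the `N = 2` twin of ★ (GL-1) `K2E3GL3FinConjBoxes` (K2E3-p23 (g4)).  2026-09-04.
-/
import Summits.HodgeConjecture.HodgeConjecture.Theorems.K2E3GL2ModCentre             -- ★ (2F-a) p858726 (this seat): `Ḡ = GL₂(F) ⧸ Z` frame, scalars, compactness criterion, one-parameter Cartan cover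
import HarnessLib

/-!
# Crux `H413` — K2-LIT E3, road «GL₂-sc», brick (2E-a1): NORMALISED LIFTS AND THE BOX ESTIMATES ON `GL₂(F)` — entries, determinant and the DIAGONAL LOWER
# BOUNDS for the one near-Borel shape (the `N = 2` twin of ★ (GL-1) `K2E3GL3FinConjBoxes`, K2E3-p23 (g4))

Cell `hodgecm-mathlib`, Track B, line `K2_E3_EllipticInputs`, road «GL₂-sc» = Harish-Chandra's local integrability for supercuspidal `GL₂(F)` (letter (S-C′-GL₂sc) of the
hosted leaf (nsc-S-C′); road owner K2E5-p17 (g5); BRICK LIST v1.1 `K2/K2E5-p17/g5/BRICKLIST-GL2sc-v1.1.K2E5-p17-g5.md`); seat K2E5-p17 (g5).  THEOREMS ONLY; count-neutral helper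
(`--supports stmt-HodgeConjecture-24833 --as helper`).

THE MATHEMATICS (matrix algebra over a `ℤᵐ⁰`-valued field; no measure theory).
* §1 `exists_normalized_lift` — every class in `Ḡ = GL₂(F) ⧸ Z` has a lift `h` with ALL entries of valuation `≤ 1` and ONE entry of valuation `= 1` (scale by `ϖᵐ·1`).
* §2 `v_det_le_of_entries_le` (`v(det y) ≤ exp(2M)`), `exists_entry_one_le_of_one_le_v_det` (`1 ≤ v(det y) ⇒` some entry has `v ≥ 1`),
  `inv_entries_le_of_scaleBound` ∕ `v_det_ge_of_scaleBound` — from the SCALE-INVARIANT bound `v(y i j)·v(y⁻¹ i' j') ≤ exp 2N` of ★ (2F-a)'s compactness criterion at a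
  normalised lift: `v(h⁻¹ i j) ≤ exp 2N`, `exp(−4N) ≤ v(det h)`; `entries_le_of_scaleBound_of_one_le_v_det_inv` — for `y = t h t⁻¹` (any lift of a box point,
  `v(det y⁻¹) ≥ 1`): ALL entries of `y` are `≤ exp 2N`; `one_le_v_det_conj_inv`.
* §3 **DIAGONAL LOWER BOUNDS** for the near-Borel shape (`v(h₀₁) ≤ exp(M − d)`, `2M + M' < d`): `v(h₀₀ h₁₁) = v(det h)` and `exp(−(M' + M)) ≤ v(h₀₀)`, `≤ v(h₁₁)`.
* §4 `coe_diagonalGL_mul_apply`, **`diffSq_torusRow_mul`** — left multiplication by `diag(u,1)` scales row `0` and turns the collision quadratic `Q(h) = (h₀₀ − h₁₁)²` into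
  the MONIC QUADRATIC `(u h₀₀)² + c (u h₀₀) + e`, `c = −2h₁₁`, `e = h₁₁²` (the input shape of ★ GL-D2 `unitsQuadraticFibre`).

HONEST LABEL: HC_CM is proved only modulo the 7 printed citations (2 remaining named inputs: hLiu418 = stmt-HodgeConjecture-24832, h413 =
stmt-HodgeConjecture-24833) until rung 0 closes; elementary, closes no organ by itself.

## References
* [HarishChandra1970] Harish-Chandra (notes by G. van Dijk), *Harmonic Analysis on Reductive p-adic Groups*, LNM 162 (1970), Part VII §2 (near-singular boxes).
* [BruhatTits1972] F. Bruhat, J. Tits, *Groupes réductifs sur un corps local I*, Publ. Math. IHÉS 41 (1972), (4.4.3).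
* [Serre1979] J.-P. Serre, *Local Fields*, GTM 67 (1979), Ch. II §1 (ultrametric inequality).
-/

set_option autoImplicit false
-- the mandated namespace repeats `HodgeConjecture.HodgeConjecture`, as in every `Theorems/*.lean` of this sub-problem
set_option linter.dupNamespace false

noncomputable section

open Set ValuativeRel Matrix
open scoped MatrixGroups Pointwise WithZero Valued

namespace Summit.HodgeConjecture.HodgeConjecture.Cruxes.H413.K2E3GL2FinConjBoxes

open Literature.NumberTheory.Automorphic K2E3GL2ModCentre

variable {F : Type*} [Field F] [Valued F ℤᵐ⁰]

/-! ## §1 Normalised lifts -/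

/-- **NORMALISED LIFTS**: every class of `GL₂(F) ⧸ Z` has a representative all of whose entries have valuation `≤ 1`, one of them `= 1` (scale any representative by
the central `ϖᵐ·1`, `exp m =` the largest entry valuation). [cite: BruhatTits1972, (4.4.3)] -/
theorem exists_normalized_lift {ϖ : F} (hϖ : Valued.v ϖ = WithZero.exp (-1 : ℤ)) (hϖ0 : ϖ ≠ 0) (x : GL (Fin 2) F ⧸ Subgroup.center (GL (Fin 2) F)) :
    ∃ h : GL (Fin 2) F, (QuotientGroup.mk h : GL (Fin 2) F ⧸ Subgroup.center (GL (Fin 2) F)) = x ∧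
      (∀ i j, Valued.v ((h : Matrix (Fin 2) (Fin 2) F) i j) ≤ 1) ∧ ∃ i j, Valued.v ((h : Matrix (Fin 2) (Fin 2) F) i j) = 1 := by
  induction x using QuotientGroup.induction_on with
  | H g =>
    obtain ⟨p, -, hp⟩ := Finset.exists_max_image Finset.univ (fun p : Fin 2 × Fin 2 => Valued.v ((g : Matrix (Fin 2) (Fin 2) F) p.1 p.2)) Finset.univ_nonempty
    -- the maximal entry is non-zero
    have hne : Valued.v ((g : Matrix (Fin 2) (Fin 2) F) p.1 p.2) ≠ 0 := by
      intro h0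
      have hzero : (g : Matrix (Fin 2) (Fin 2) F) = 0 := by
        ext i j
        have := hp (i, j) (Finset.mem_univ _)
        rw [h0, le_zero_iff, Valuation.zero_iff] at this
        exact this
      exact Matrix.GeneralLinearGroup.det_ne_zero g (by rw [hzero]; exact Matrix.det_zero)
    -- scale by `ϖᵐ · 1`, `exp m = v(g_p)`
    set m : ℤ := WithZero.log (Valued.v ((g : Matrix (Fin 2) (Fin 2) F) p.1 p.2)) with hm
    have hexp : WithZero.exp m = Valued.v ((g : Matrix (Fin 2) (Fin 2) F) p.1 p.2) := by rw [hm, WithZero.exp_log hne]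
    have hvϖm : Valued.v (ϖ ^ m) = WithZero.exp (-m) := by
      rw [map_zpow₀, hϖ, ← WithZero.exp_zsmul, smul_eq_mul, mul_neg_one]
    refine ⟨zpowDiagGL (n := 2) hϖ0 (fun _ => m) * g, ?_, fun i j => ?_, ⟨p.1, p.2, ?_⟩⟩
    · rw [QuotientGroup.mk_mul, mk_zpowDiagGL_const_eq_one, one_mul]
    · rw [zpowDiagGL_const_mul_apply, map_mul, hvϖm]
      calc WithZero.exp (-m) * Valued.v ((g : Matrix (Fin 2) (Fin 2) F) i j) ≤ WithZero.exp (-m) * WithZero.exp m :=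
            mul_le_mul' le_rfl (hexp ▸ hp (i, j) (Finset.mem_univ _))
        _ = 1 := by rw [← WithZero.exp_add, neg_add_cancel, WithZero.exp_zero]
    · rw [zpowDiagGL_const_mul_apply, map_mul, hvϖm, ← hexp, ← WithZero.exp_add, neg_add_cancel, WithZero.exp_zero]

/-! ## §2 Determinants and the scale-invariant bound -/

/-- Entries `≤ exp M` ⇒ `v(det y) ≤ exp(2M)` (two double products, ultrametric). [cite: Serre1979, Ch. II §1] -/
theorem v_det_le_of_entries_le {M : ℤ} (A : Matrix (Fin 2) (Fin 2) F) (hA : ∀ i j, Valued.v (A i j) ≤ WithZero.exp M) :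
    Valued.v A.det ≤ WithZero.exp (2 * M) := by
  have h2 : ∀ a b : F, Valued.v a ≤ WithZero.exp M → Valued.v b ≤ WithZero.exp M → Valued.v (a * b) ≤ WithZero.exp (2 * M) := by
    intro a b ha hb
    rw [map_mul, two_mul, WithZero.exp_add]
    exact mul_le_mul' ha hb
  rw [Matrix.det_fin_two]
  exact Valuation.map_sub_le _ (h2 _ _ (hA _ _) (hA _ _)) (h2 _ _ (hA _ _) (hA _ _))

/-- If `1 ≤ v(det y)` then some entry of `y` has valuation `≥ 1` (else both double products are `< 1`). [cite: Serre1979, Ch. II §1] -/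
theorem exists_entry_one_le_of_one_le_v_det (A : Matrix (Fin 2) (Fin 2) F) (hA : 1 ≤ Valued.v A.det) : ∃ i j, 1 ≤ Valued.v (A i j) := by
  by_contra hcon
  simp only [not_exists, not_le] at hcon
  have h2 : ∀ a b : F, Valued.v a < 1 → Valued.v b < 1 → Valued.v (a * b) < 1 := by
    intro a b ha hb
    rw [map_mul]
    calc Valued.v a * Valued.v b ≤ Valued.v a * 1 := mul_le_mul' le_rfl hb.le
      _ = Valued.v a := mul_one _
      _ < 1 := ha
  have hlt : Valued.v A.det < 1 := by
    rw [Matrix.det_fin_two]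
    exact Valuation.map_sub_lt _ (h2 _ _ (hcon _ _) (hcon _ _)) (h2 _ _ (hcon _ _) (hcon _ _))
  exact absurd hA (not_le.2 hlt)

/-- From the scale-invariant bound at a NORMALISED element: all entries of `h⁻¹` are `≤ exp 2N`. [folklore] -/
theorem inv_entries_le_of_scaleBound {N : ℕ} (h : GL (Fin 2) F)
    (hb : ∀ i j i' j', Valued.v ((h : Matrix (Fin 2) (Fin 2) F) i j) * Valued.v (((h⁻¹ : GL (Fin 2) F) : Matrix (Fin 2) (Fin 2) F) i' j') ≤ WithZero.exp (2 * (N : ℤ)))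
    (hone : ∃ i j, Valued.v ((h : Matrix (Fin 2) (Fin 2) F) i j) = 1) (i' j' : Fin 2) :
    Valued.v (((h⁻¹ : GL (Fin 2) F) : Matrix (Fin 2) (Fin 2) F) i' j') ≤ WithZero.exp (2 * (N : ℤ)) := by
  obtain ⟨i, j, hij⟩ := hone
  have := hb i j i' j'
  rwa [hij, one_mul] at this

/-- From the scale-invariant bound at a normalised element: `exp(−4N) ≤ v(det h)`. [folklore] -/
theorem v_det_ge_of_scaleBound {N : ℕ} (h : GL (Fin 2) F)
    (hb : ∀ i j i' j', Valued.v ((h : Matrix (Fin 2) (Fin 2) F) i j) * Valued.v (((h⁻¹ : GL (Fin 2) F) : Matrix (Fin 2) (Fin 2) F) i' j') ≤ WithZero.exp (2 * (N : ℤ)))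
    (hone : ∃ i j, Valued.v ((h : Matrix (Fin 2) (Fin 2) F) i j) = 1) :
    WithZero.exp (-(4 * (N : ℤ))) ≤ Valued.v (h : Matrix (Fin 2) (Fin 2) F).det := by
  have hinv := v_det_le_of_entries_le (((h⁻¹ : GL (Fin 2) F) : Matrix (Fin 2) (Fin 2) F)) (inv_entries_le_of_scaleBound h hb hone)
  have hdet : (((h⁻¹ : GL (Fin 2) F) : Matrix (Fin 2) (Fin 2) F)).det = ((h : Matrix (Fin 2) (Fin 2) F).det)⁻¹ := by
    rw [Matrix.coe_units_inv, Matrix.det_nonsing_inv, Ring.inverse_eq_inv']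
  rw [hdet, map_inv₀, show (2 : ℤ) * (2 * (N : ℤ)) = 4 * N by ring] at hinv
  have h0 : Valued.v (h : Matrix (Fin 2) (Fin 2) F).det ≠ 0 := (Valuation.ne_zero_iff _).2 (Matrix.GeneralLinearGroup.det_ne_zero h)
  rw [WithZero.exp_neg]
  exact (inv_le_comm₀ (zero_lt_iff.2 h0) WithZero.exp_pos).1 hinv

/-- **ALL ENTRIES OF `t h t⁻¹` ARE `≤ exp 2N`** when `y = t h t⁻¹` satisfies the scale-invariant bound and `1 ≤ v(det y⁻¹)` (so some entry of `y⁻¹` has `v ≥ 1`).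
[cite: HarishChandra1970, Part VII §2] -/
theorem entries_le_of_scaleBound_of_one_le_v_det_inv {N : ℕ} (y : GL (Fin 2) F)
    (hb : ∀ i j i' j', Valued.v ((y : Matrix (Fin 2) (Fin 2) F) i j) * Valued.v (((y⁻¹ : GL (Fin 2) F) : Matrix (Fin 2) (Fin 2) F) i' j') ≤ WithZero.exp (2 * (N : ℤ)))
    (hdet : 1 ≤ Valued.v (((y⁻¹ : GL (Fin 2) F) : Matrix (Fin 2) (Fin 2) F)).det) (i j : Fin 2) :
    Valued.v ((y : Matrix (Fin 2) (Fin 2) F) i j) ≤ WithZero.exp (2 * (N : ℤ)) := by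
  obtain ⟨i', j', h1⟩ := exists_entry_one_le_of_one_le_v_det _ hdet
  calc Valued.v ((y : Matrix (Fin 2) (Fin 2) F) i j) = Valued.v ((y : Matrix (Fin 2) (Fin 2) F) i j) * 1 := (mul_one _).symm
    _ ≤ Valued.v ((y : Matrix (Fin 2) (Fin 2) F) i j) * Valued.v (((y⁻¹ : GL (Fin 2) F) : Matrix (Fin 2) (Fin 2) F) i' j') := mul_le_mul' le_rfl h1
    _ ≤ WithZero.exp (2 * (N : ℤ)) := hb i j i' j'

/-- `v(det (t h t⁻¹)⁻¹) = v(det h)⁻¹ ≥ 1` when all entries of `h` are `≤ 1`. [folklore] -/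
theorem one_le_v_det_conj_inv (t h : GL (Fin 2) F) (hh : ∀ i j, Valued.v ((h : Matrix (Fin 2) (Fin 2) F) i j) ≤ 1) :
    1 ≤ Valued.v ((((t * h * t⁻¹)⁻¹ : GL (Fin 2) F)) : Matrix (Fin 2) (Fin 2) F).det := by
  have hle : Valued.v (h : Matrix (Fin 2) (Fin 2) F).det ≤ 1 := by
    have := v_det_le_of_entries_le (M := 0) (h : Matrix (Fin 2) (Fin 2) F) (fun i j => by rw [WithZero.exp_zero]; exact hh i j)
    rwa [mul_zero, WithZero.exp_zero] at this
  have h0 : Valued.v (h : Matrix (Fin 2) (Fin 2) F).det ≠ 0 := (Valuation.ne_zero_iff _).2 (Matrix.GeneralLinearGroup.det_ne_zero h)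
  have hdet : ((((t * h * t⁻¹)⁻¹ : GL (Fin 2) F)) : Matrix (Fin 2) (Fin 2) F).det = ((h : Matrix (Fin 2) (Fin 2) F).det)⁻¹ := by
    rw [Matrix.coe_units_inv, Matrix.det_nonsing_inv, Ring.inverse_eq_inv', Units.val_mul, Units.val_mul, Matrix.det_mul, Matrix.det_mul,
      Matrix.coe_units_inv, Matrix.det_nonsing_inv, Ring.inverse_eq_inv']
    have ht0 : (t : Matrix (Fin 2) (Fin 2) F).det ≠ 0 := Matrix.GeneralLinearGroup.det_ne_zero t
    field_simp
  rw [hdet, map_inv₀]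
  exact one_le_inv_iff₀.2 ⟨zero_lt_iff.2 h0, hle⟩

/-! ## §3 Diagonal lower bounds for the near-Borel shape -/

/-- **THE NEAR-BOREL SHAPE**: if `v(hᵢⱼ) ≤ exp M` for all entries, `v(h₀₁) ≤ exp(M − d)`, `exp(−M') ≤ v(det h)` and `2M + M' < d`, then `v(h₀₀ h₁₁) = v(det h)` and
`exp(−(M' + M)) ≤ v(h₀₀)`, `exp(−(M' + M)) ≤ v(h₁₁)` (`det = h₀₀h₁₁ − h₀₁h₁₀` and `v(h₀₁h₁₀) ≤ exp(2M − d) < exp(−M′) ≤ v(det)`).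
[cite: HarishChandra1970, Part VII §2] -/
theorem v_diag_ge_shape {M M' d : ℕ} (hd : 2 * M + M' < d) (h : GL (Fin 2) F)
    (hall : ∀ i j, Valued.v ((h : Matrix (Fin 2) (Fin 2) F) i j) ≤ WithZero.exp (M : ℤ))
    (h01 : Valued.v ((h : Matrix (Fin 2) (Fin 2) F) 0 1) ≤ WithZero.exp ((M : ℤ) - d))
    (hdet : WithZero.exp (-(M' : ℤ)) ≤ Valued.v (h : Matrix (Fin 2) (Fin 2) F).det) :
    Valued.v ((h : Matrix (Fin 2) (Fin 2) F) 0 0 * (h : Matrix (Fin 2) (Fin 2) F) 1 1) = Valued.v (h : Matrix (Fin 2) (Fin 2) F).det ∧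
      WithZero.exp (-((M' : ℤ) + M)) ≤ Valued.v ((h : Matrix (Fin 2) (Fin 2) F) 0 0) ∧
        WithZero.exp (-((M' : ℤ) + M)) ≤ Valued.v ((h : Matrix (Fin 2) (Fin 2) F) 1 1) := by
  set A : Matrix (Fin 2) (Fin 2) F := (h : Matrix (Fin 2) (Fin 2) F) with hA
  have hdetA : A.det = A 0 0 * A 1 1 + -(A 0 1 * A 1 0) := by rw [Matrix.det_fin_two]; ring
  have hlt : (2 * (M : ℤ) - d) < -(M' : ℤ) := by omega
  have hRlt : Valued.v (-(A 0 1 * A 1 0)) < Valued.v A.det := by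
    rw [Valuation.map_neg, map_mul]
    calc Valued.v (A 0 1) * Valued.v (A 1 0) ≤ WithZero.exp ((M : ℤ) - d) * WithZero.exp (M : ℤ) := mul_le_mul' h01 (hall 1 0)
      _ = WithZero.exp (2 * (M : ℤ) - d) := by rw [← WithZero.exp_add]; ring_nf
      _ < WithZero.exp (-(M' : ℤ)) := WithZero.exp_lt_exp.2 hlt
      _ ≤ Valued.v A.det := hdet
  -- hence `v(A₀₀ A₁₁) = v(det A)`
  have hmain : Valued.v (A 0 0 * A 1 1) = Valued.v A.det := by
    have he : A 0 0 * A 1 1 = A.det + -(-(A 0 1 * A 1 0)) := by rw [hdetA]; ring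
    rw [he, Valuation.map_add_eq_of_lt_left]
    rw [Valuation.map_neg]; exact hRlt
  refine ⟨hmain, ?_, ?_⟩
  · have key : WithZero.exp (-(M' : ℤ)) ≤ Valued.v (A 0 0) * WithZero.exp (M : ℤ) :=
      hdet.trans (by rw [← hmain, map_mul]; exact mul_le_mul' le_rfl (hall 1 1))
    calc WithZero.exp (-((M' : ℤ) + M)) = WithZero.exp (-(M' : ℤ)) * WithZero.exp (-(M : ℤ)) := by rw [← WithZero.exp_add]; ring_nf
      _ ≤ Valued.v (A 0 0) * WithZero.exp (M : ℤ) * WithZero.exp (-(M : ℤ)) := mul_le_mul' key le_rfl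
      _ = Valued.v (A 0 0) := by rw [mul_assoc, ← WithZero.exp_add, add_neg_cancel, WithZero.exp_zero, mul_one]
  · have key : WithZero.exp (-(M' : ℤ)) ≤ WithZero.exp (M : ℤ) * Valued.v (A 1 1) :=
      hdet.trans (by rw [← hmain, map_mul]; exact mul_le_mul' (hall 0 0) le_rfl)
    calc WithZero.exp (-((M' : ℤ) + M)) = WithZero.exp (-(M : ℤ)) * WithZero.exp (-(M' : ℤ)) := by rw [← WithZero.exp_add]; ring_nf
      _ ≤ WithZero.exp (-(M : ℤ)) * (WithZero.exp (M : ℤ) * Valued.v (A 1 1)) := mul_le_mul' le_rfl key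
      _ = Valued.v (A 1 1) := by rw [← mul_assoc, ← WithZero.exp_add, neg_add_cancel, WithZero.exp_zero, one_mul]

/-! ## §4 The torus moves row `0`; the collision quadratic becomes a monic quadratic in `u · h₀₀` -/

omit [Valued F ℤᵐ⁰] in
/-- Left multiplication by `diag(d)` scales the rows: `(diag(d) · h)ᵢⱼ = dᵢ hᵢⱼ`. [folklore] -/
theorem coe_diagonalGL_mul_apply (d : Fin 2 → Fˣ) (h : GL (Fin 2) F) (i j : Fin 2) :
    ((diagonalGL (Fin 2) F d * h : GL (Fin 2) F) : Matrix (Fin 2) (Fin 2) F) i j = (d i : F) * (h : Matrix (Fin 2) (Fin 2) F) i j := by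
  rw [Units.val_mul, coe_diagonalGL, Matrix.diagonal_mul]

omit [Valued F ℤᵐ⁰] in
/-- **`Q(diag(u,1)·h) = (u h₀₀)² + c (u h₀₀) + e`** with `c = −2h₁₁`, `e = h₁₁²`, where `Q(g) = (g₀₀ − g₁₁)²` is the collision quadratic of the near-Borel shape (the torus
scales row `0` only). [folklore] -/
theorem diffSq_torusRow_mul (u : Fˣ) (h : GL (Fin 2) F) :
    (((diagonalGL (Fin 2) F ![u, 1] * h : GL (Fin 2) F) : Matrix (Fin 2) (Fin 2) F) 0 0 - ((diagonalGL (Fin 2) F ![u, 1] * h : GL (Fin 2) F) : Matrix (Fin 2) (Fin 2) F) 1 1) ^ 2 =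
    ((u : F) * (h : Matrix (Fin 2) (Fin 2) F) 0 0) ^ 2 + (-(2 * (h : Matrix (Fin 2) (Fin 2) F) 1 1)) * ((u : F) * (h : Matrix (Fin 2) (Fin 2) F) 0 0) +
      (h : Matrix (Fin 2) (Fin 2) F) 1 1 ^ 2 := by
  simp only [coe_diagonalGL_mul_apply]
  simp
  ring

end Summit.HodgeConjecture.HodgeConjecture.Cruxes.H413.K2E3GL2FinConjBoxes

end
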